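import Mathlib.Analysis.Convex.Deriv

/-!
# Charted zero-excess layered-lattice Liouville — ZZZYRCM: the INTERPOLATION-VERTEX lemma (CELLBOX-K between-grid closure)

Cell `decomp-a2c`, lens 2, generation 99.  Critic r1818 fixed the CELLBOX-K K-file recipe per parameter box `B = Π_a [l_a, h_a]` (k ≤ 5 axes):
certify the cluster form at the `2^k` VERTICES, bound the PURE second derivatives along each axis by `L_aa`, and conclude in the interior by the
«three-line interpolation lemma».  This file IS that lemma, typed once, calculus-free at the point of use:

* `vertex_interp_one` — one axis: if `t ↦ g t − (L/2)·t²` is CONCAVE on `[l, h]` (i.e. `g'' ≤ L`), `0 ≤ L`, and `m ≤ g l`, `m ≤ g h`, then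
  `m − L·(h − l)²/8 ≤ g t` on `[l, h]` (a concave function lies above its chord; `λ(1 − λ) ≤ 1/4`);
* ★ `vertex_interp_box` — a box `Π_a [l a, h a]` over a finite index type: if along every axis-parallel segment of the box
  `t ↦ f (update ξ a t) − (L a / 2)·t²` is concave, and `m ≤ f` at every VERTEX, then `m − Σ_a L a·(h a − l a)²/8 ≤ f ξ` on the whole box
  (induction on the set of free coordinates; mixed derivatives never enter — multilinear functions are interpolated exactly);
* `concaveOn_sub_sq_of_deriv2_le` — the C² entry point: `g' , g''` with `HasDerivAt` on `[l, h]` and `g'' ≤ L` give the concavity hypothesis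
  (Mathlib `concaveOn_of_hasDerivWithinAt2_nonpos`).

USE (K-file): for each test vector `v`, `f ξ := Q_ξ(v) − κ₁·nnForm(v) − debit_ξ(v)`, `m := gap_min·nnForm(v)` from the vertex certificates,
`L a := L_aa·nnForm(v)` from the analytic pure-axis bound (memo NODE-g99 §8.4: only first-shell bonds matter, `L_aa ≈ Φ(q_min)·|u|²`,
`Φ(q) = 5418 q⁻⁸ + 1464 q⁻⁵`, `q = r²`) ⇒ `Q_ξ(v) − κ₁·nnForm(v) − debit_ξ(v) ≥ (gap_min − Σ_a L_aa Δ_a²/8)·nnForm(v) ≥ 0` on the box.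

Theorem file (0 def, 3 theorems); imports Mathlib only; no instance / notation / option; 0 sorry. [g99]
-/

namespace Summit.AtomisticToContinuum.Crystallization.Theorems.ChartedZeroExcessLayeredLatticeLiouville

/-- **ONE AXIS**: a function whose second derivative is at most `L` (stated as: `g − (L/2)·t²` concave on `[l, h]`) and which is `≥ m` at the two
endpoints is `≥ m − L (h − l)² / 8` on the whole segment. [g99] -/
theorem vertex_interp_one {g : ℝ → ℝ} {l h L m : ℝ} (hlh : l ≤ h) (hL : 0 ≤ L)
    (hc : ConcaveOn ℝ (Set.Icc l h) (fun t => g t - L / 2 * t ^ 2)) (hl : m ≤ g l) (hh : m ≤ g h)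
    {t : ℝ} (ht : t ∈ Set.Icc l h) : m - L * (h - l) ^ 2 / 8 ≤ g t := by
  rcases eq_or_lt_of_le hlh with heq | hlt
  · subst heq
    have htl : t = l := le_antisymm ht.2 ht.1
    subst htl
    have : L * (t - t) ^ 2 / 8 = 0 := by ring
    linarith
  · have hd : 0 < h - l := sub_pos.mpr hlt
    set c := (t - l) / (h - l) with hc_def
    have hc0 : 0 ≤ c := div_nonneg (sub_nonneg.mpr ht.1) hd.le
    have hc1 : c ≤ 1 := by rw [hc_def, div_le_one hd]; linarith [ht.2]
    have htl : (1 - c) * l + c * h = t := by rw [hc_def]; field_simp; ring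
    have key := hc.2 (Set.left_mem_Icc.mpr hlh) (Set.right_mem_Icc.mpr hlh) (sub_nonneg.mpr hc1) hc0 (by ring)
    simp only [smul_eq_mul] at key
    rw [htl] at key
    -- key : (1 - c) * (g l - L/2*l^2) + c * (g h - L/2*h^2) ≤ g t - L/2*t^2
    have hid : L / 2 * ((1 - c) * l ^ 2 + c * h ^ 2 - t ^ 2) = L / 2 * (c * (1 - c) * (h - l) ^ 2) := by
      rw [← htl]; ring
    have h14 : c * (1 - c) ≤ 1 / 4 := by nlinarith [sq_nonneg (c - 1 / 2)]
    have hq : L / 2 * (c * (1 - c) * (h - l) ^ 2) ≤ L * (h - l) ^ 2 / 8 := by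
      have := mul_le_mul_of_nonneg_left h14 (by positivity : 0 ≤ L / 2 * (h - l) ^ 2)
      nlinarith [this]
    have hm1 : 0 ≤ (1 - c) * (g l - m) := mul_nonneg (sub_nonneg.mpr hc1) (sub_nonneg.mpr hl)
    have hm2 : 0 ≤ c * (g h - m) := mul_nonneg hc0 (sub_nonneg.mpr hh)
    nlinarith [key, hid, hq, hm1, hm2]

/-- ★ **THE INTERPOLATION-VERTEX LEMMA ON A BOX**: over a finite index type, if along every axis-parallel segment of the box `Π_a [l a, h a]` the
function `t ↦ f (update ξ a t) − (L a / 2)·t²` is concave (pure second derivative `≤ L a`), `0 ≤ L`, and `m ≤ f` at every vertex (every coordinate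
an endpoint), then `m − Σ_a L a·(h a − l a)²/8 ≤ f ξ` at every point of the box.  (Induction on the finite set of coordinates that are allowed to be
interior; the step is `vertex_interp_one` along the new axis between the two face points.) [g99] -/
theorem vertex_interp_box {ι : Type*} [Fintype ι] [DecidableEq ι] {f : (ι → ℝ) → ℝ} {l h L : ι → ℝ} {m : ℝ}
    (hlh : ∀ a, l a ≤ h a) (hL : ∀ a, 0 ≤ L a)
    (hc : ∀ (a : ι) (ξ : ι → ℝ), (∀ b, ξ b ∈ Set.Icc (l b) (h b)) →
      ConcaveOn ℝ (Set.Icc (l a) (h a)) (fun t => f (Function.update ξ a t) - L a / 2 * t ^ 2))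
    (hm : ∀ ξ : ι → ℝ, (∀ b, ξ b = l b ∨ ξ b = h b) → m ≤ f ξ)
    (ξ : ι → ℝ) (hξ : ∀ b, ξ b ∈ Set.Icc (l b) (h b)) :
    m - ∑ a, L a * (h a - l a) ^ 2 / 8 ≤ f ξ := by
  -- `key S`: the claim for points whose coordinates outside `S` sit at endpoints, with the sum over `S` only
  have key : ∀ S : Finset ι, ∀ ξ : ι → ℝ, (∀ b, ξ b ∈ Set.Icc (l b) (h b)) → (∀ b, b ∉ S → ξ b = l b ∨ ξ b = h b) →
      m - ∑ a ∈ S, L a * (h a - l a) ^ 2 / 8 ≤ f ξ := by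
    intro S
    refine Finset.induction_on S ?_ ?_
    · intro ξ _ hv
      simpa using hm ξ (fun b => hv b (Finset.notMem_empty b))
    · intro a S haS ih ξ hξ hv
      have hface : ∀ c ∈ Set.Icc (l a) (h a), ∀ b, Function.update ξ a c b ∈ Set.Icc (l b) (h b) := by
        intro c hc b
        by_cases hb : b = a
        · subst hb; simpa using hc
        · rw [Function.update_of_ne hb]; exact hξ b
      have hvert : ∀ c, (c = l a ∨ c = h a) → ∀ b, b ∉ S →
          Function.update ξ a c b = l b ∨ Function.update ξ a c b = h b := by
        intro c hc b hb
        by_cases hba : b = a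
        · subst hba; simpa using hc
        · rw [Function.update_of_ne hba]
          exact hv b (by simp [Finset.mem_insert, hba, hb])
      have h1 := ih _ (hface _ (Set.left_mem_Icc.mpr (hlh a))) (hvert _ (Or.inl rfl))
      have h2 := ih _ (hface _ (Set.right_mem_Icc.mpr (hlh a))) (hvert _ (Or.inr rfl))
      have h3 := vertex_interp_one (hlh a) (hL a) (hc a ξ hξ) h1 h2 (hξ a)
      rw [Function.update_eq_self] at h3
      rw [Finset.sum_insert haS]
      linarith
  simpa using key Finset.univ ξ hξ (fun b hb => absurd (Finset.mem_univ b) hb)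

/-- **C² ENTRY POINT**: first and second derivatives on `[l, h]` with `g'' ≤ L` give the concavity hypothesis of `vertex_interp_one` /
`vertex_interp_box`. [g99] -/
theorem concaveOn_sub_sq_of_deriv2_le {g g' g'' : ℝ → ℝ} {l h L : ℝ}
    (hg : ∀ t ∈ Set.Icc l h, HasDerivAt g (g' t) t) (hg' : ∀ t ∈ Set.Icc l h, HasDerivAt g' (g'' t) t)
    (hL : ∀ t ∈ Set.Icc l h, g'' t ≤ L) :
    ConcaveOn ℝ (Set.Icc l h) (fun t => g t - L / 2 * t ^ 2) := by
  have hsub : interior (Set.Icc l h) ⊆ Set.Icc l h := interior_subset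
  have hsq : ∀ t : ℝ, HasDerivAt (fun t => L / 2 * t ^ 2) (L * t) t := fun t => by
    have h := ((hasDerivAt_id' t).mul (hasDerivAt_id' t)).const_mul (L / 2)
    have e1 : (fun t : ℝ => L / 2 * t ^ 2) = fun y => L / 2 * (y * y) := by
      funext y; rw [sq]
    rw [e1]
    exact h.congr_deriv (by ring)
  have hlin : ∀ t : ℝ, HasDerivAt (fun t => L * t) L t := fun t => by
    simpa using (hasDerivAt_id t).const_mul L
  refine concaveOn_of_hasDerivWithinAt2_nonpos (convex_Icc l h) (f' := fun t => g' t - L * t)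
    (f'' := fun t => g'' t - L) ?_ ?_ ?_ ?_
  · exact fun t ht => ((hg t ht).continuousAt.sub (hsq t).continuousAt).continuousWithinAt
  · exact fun t ht => ((hg t (hsub ht)).sub (hsq t)).hasDerivWithinAt
  · exact fun t ht => ((hg' t (hsub ht)).sub (hlin t)).hasDerivWithinAt
  · intro t ht
    have := hL t (hsub ht)
    show g'' t - L ≤ 0
    linarith

end Summit.AtomisticToContinuum.Crystallization.Theorems.ChartedZeroExcessLayeredLatticeLiouville
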